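import Summits.CriticalPhenomena.PercolationContinuityZ3.Theorems.PercNearOneGluingNoHeavyQuantWindowExtremeLaw
import Summits.CriticalPhenomena.PercolationContinuityZ3.Theorems.PercNearOneGluingNoHeavyQuantAtomLaw
import Summits.CriticalPhenomena.PercolationContinuityZ3.Theorems.PercNearOneGluingNoHeavyQuantCornerStaircase
import HarnessLib

/-!
# QUANT lane R8, T-DEC: **THE STRUCTURE OF THE EXTREME POINTS OF THE WINDOW POLYTOPE** — at most one low of the top layer, or the
# balanced two-segment atom `atomLaw` (census-2 g56's Type I / Type II closed forms, now a theorem): case (B) of memo WINDOW-ATOMS-G57 §2.4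
# read structurally (the assembly `windowExtreme_shapeOrd` follows in `…QuantConvAtomsReduction`)

builds on p205010 (kernel theorem, internal audit signed; external expert review pending)

Support file (`--supports stmt-CriticalPhenomena-4575`), QUANT lane seat prim-quant-census-2 (gen 58), rung R8 of
`run/shared/lean/prim/quant/LADDER.md`.  Theorems only, standard axioms, no sorries.  Memo `…/prim-quant-census-2-g58/EXTREME-ATOMS-G58.md` §1.

THE ARGUMENT (case (B): a saturated layer `J*`, no mass above `j`).  g57's sub-cases: (B i) one segment `(l₀,h₀)` with `c₀ = u` ⟹ the law is
that segment (one low); (B ii) a segment and an unfull absorber ⟹ one low; (B iv) contradictory; **(B iii) two corner segments `σ₀ = (l₀,h₀)`,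
`σ′ = (l′,h′)` beyond `J*`: the two-sided move is `(c′ − u)·b_σ₀ + (u − c₀)·b_σ′` (`b_σ = e_l + c_σ e_h`) and the law is proportional to it
(`law_eq_of_pieces`); if `l′ = l₀` one low; otherwise both low masses are positive, so `c′ − u` and `u − c₀` have the sign of the constant,
i.e. `c₀`, `c′` lie on opposite sides of `u = x/(1−x)`, and normalising (`eq_of_smul_eq_smul`, `sum_range_atomLaw`) the law IS
`atomLaw x T j l₁ h₁ l₂ h₂` with `(l₁,h₁)` the expensive and `(l₂,h₂)` the cheap segment** — the atlas identity
`(c₁ − u)·ν_l₁ = (u − c₂)·ν_l₂`, absorber loads `c_i ν_l_i`, absorber mass `x`.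

* **`LawDec.shape_of_tight_noGiant`** — case (B): at most one low, or `vecLaw M v = atomLaw …` with `AtomData` and the staircase order.
* the staircase order `(l₁ < l₂ ∧ h₂ ≤ h₁) ∨ (l₂ < l₁ ∧ h₁ ≤ h₂)` of the two segments comes from `corner_staircase` (`…QuantCornerStaircase`); the
  assembly over the three cases (`windowExtreme_shapeOrd`, `windowExtreme_shape`) is in `…QuantConvAtomsReduction`.  With (O1) of `…QuantAtomOrder`
  (a window-DEC atom whose cheap segment straddles has `l₁ < l₂`) only the CROSSED order `l₁ < l₂ ∧ h₂ ≤ h₁` survives in the residue — census-2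
  g56's atlas ("never the swapped assignment", 0 / 2 206) as a theorem.

[this work]; nothing here is cited as a published result.  The gluing rows served [cite: KozmaNitzan2024, Conjecture 3 (p. 15)]; product
measure [cite: Grimmett1999, §1.3 p. 10].
-/

noncomputable section

namespace Summit.CriticalPhenomena.PercolationContinuityZ3.Theorems

namespace Quant

open Finset

namespace LawDec

/-- indicator of equality of naturals, as a real number -/
local notation3 "𝟙[" a ", " b "]" => (if (a : ℕ) = (b : ℕ) then (1 : ℝ) else 0)

/-- **CASE (B): A SATURATED LAYER, NO MASS ABOVE THE TOP ⟹ at most one low, or the balanced two-segment atom** (memo §2.4 (B);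
in sub-case (B iii) the move is `(c′ − u)·b_σ₀ + (u − c₀)·b_σ′` and the law, being proportional to it with positive low masses, has
`c₀`, `c′` on opposite sides of `u = x/(1−x)` and low masses in the ratio `|c′ − u| : |u − c₀|`). [this work] -/
theorem shape_of_tight_noGiant (x T : ℝ) (M j w : ℕ) (v : Fin (M + 1) → ℝ) (hx0 : 0 < x) (hx1 : x < 1)
    (hvext : v ∈ (windowSet x T M j w).extremePoints ℝ) (Js : ℕ)
    (hgap : ∀ l, Js < l → l ≤ j → 2 * (l : ℝ) < T → vecLaw M v l = 0)
    (hS : x / (1 - x) * windowS x T j M (vecLaw M v) Js = ∑ h ∈ Finset.Ico (Js + 1) (M + 1), vecLaw M v h)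
    (hΓ : 0 < ∑ h ∈ Finset.Ico (Js + 1) (M + 1), vecLaw M v h)
    (hmax : ∀ J, J ≤ j → j ≤ J + w → (∀ l, J < l → l ≤ j → 2 * (l : ℝ) < T → vecLaw M v l = 0) →
      x / (1 - x) * windowS x T j M (vecLaw M v) J = ∑ h ∈ Finset.Ico (J + 1) (M + 1), vecLaw M v h →
      0 < ∑ h ∈ Finset.Ico (J + 1) (M + 1), vecLaw M v h → J ≤ Js)
    (hnogiant : ∀ g, j < g → g ≤ M → vecLaw M v g = 0) :
    (∃ q, q ≤ j ∧ ∀ k, k ≤ j → 2 * (k : ℝ) < T → vecLaw M v k ≠ 0 → k = q) ∨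
    (∃ l₁ h₁ l₂ h₂, AtomData x T j M l₁ h₁ l₂ h₂ ∧ ((l₁ < l₂ ∧ h₂ ≤ h₁) ∨ (l₂ < l₁ ∧ h₁ ≤ h₂)) ∧
      ∀ b, vecLaw M v b = atomLaw x T j l₁ h₁ l₂ h₂ b) := by
  classical
  have hv : v ∈ windowSet x T M j w := hvext.1
  set μ : ℕ → ℝ := vecLaw M v with hμdef
  have hμ0 : ∀ k, 0 ≤ μ k := fun k => by
    by_cases hk : k < M + 1
    · rw [hμdef, vecLaw_apply_of_lt v hk]; exact hv.1 _
    · rw [hμdef, vecLaw, dif_neg hk]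
  have hμM : ∀ h, M < h → μ h = 0 := fun h hh => vecLaw_apply_of_gt v hh
  have hμ1 : ∑ h ∈ Finset.range (M + 1), μ h = 1 := by rw [hμdef, sum_range_vecLaw, hv.2.1]
  have hwin : ∀ J, J ≤ j → j ≤ J + w → DECAtT x T J M μ := hv.2.2
  have hu : 0 < x / (1 - x) := div_pos hx0 (by linarith)
  obtain ⟨hF0, hsup, hrow, hcol⟩ := cornerFlow_inv x T j M μ hx0 hx1 hμ0 ((j + 1) * (j + 1)) le_rfl
  have hleM : ∀ b, 0 < μ b → b ≤ M := fun b hb => by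
    by_contra hgt; push Not at hgt; linarith [hμM b hgt]
  have hleft0 : ∀ l, 0 ≤ cornerLeftover x T j M μ l := fun l => by
    unfold cornerLeftover cornerMidFlow; linarith [hrow l]
  have hlowpos : ∀ l h, 0 < cornerMidFlow x T j M μ l h → 0 < μ l := fun l h hF => by
    obtain ⟨-, -, -, q4, -, -⟩ := hsup l h (ne_of_gt hF)
    have hle := Finset.single_le_sum (f := fun b => cornerFlow x T j M μ ((j + 1) * (j + 1)) l b) (fun b _ => hF0 l b)
      (Finset.mem_range.2 (Nat.lt_succ_of_le q4))
    have hF' : 0 < cornerFlow x T j M μ ((j + 1) * (j + 1)) l h := hF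
    linarith [hrow l]
  have hlowM : ∀ l h, 0 < cornerMidFlow x T j M μ l h → l ≤ M := fun l h hF => hleM l (hlowpos l h hF)
  -- no giant mass: every leftover vanishes
  have hΓj : ∑ h ∈ Finset.Ico (j + 1) (M + 1), μ h = 0 :=
    Finset.sum_eq_zero fun h hh => by
      obtain ⟨q1, q2⟩ := Finset.mem_Ico.1 hh
      exact hnogiant h (by omega) (by omega)
  have hCj := (decAtT_iff_cornerSucceeds x T j M μ hx0 hx1 hμ0 hμM hμ1).1 (hwin j le_rfl (Nat.le_add_right _ _))
  unfold CornerSucceeds at hCj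
  rw [hΓj] at hCj
  have hLz : ∀ l, l ≤ j → 2 * (l : ℝ) < T → cornerLeftover x T j M μ l = 0 := by
    have h0 : 0 ≤ ∑ l ∈ (Finset.range (j + 1)).filter (fun l : ℕ => 2 * (l : ℝ) < T), cornerLeftover x T j M μ l :=
      Finset.sum_nonneg fun l _ => hleft0 l
    have hz : ∑ l ∈ (Finset.range (j + 1)).filter (fun l : ℕ => 2 * (l : ℝ) < T), cornerLeftover x T j M μ l = 0 := by
      nlinarith
    exact fun l hl hlow => (Finset.sum_eq_zero_iff_of_nonneg (fun l _ => hleft0 l)).1 hz l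
      (Finset.mem_filter.2 ⟨Finset.mem_range.2 (Nat.lt_succ_of_le hl), hlow⟩)
  -- saturation yields a segment beyond `J*`
  have hSpos : 0 < windowS x T j M μ Js := by
    by_contra hle; push Not at hle; nlinarith
  obtain ⟨l₀, hl₀mem, hl₀ne⟩ := Finset.exists_ne_zero_of_sum_ne_zero (ne_of_gt hSpos)
  obtain ⟨hl₀r, hl₀low⟩ := Finset.mem_filter.1 hl₀mem
  have hl₀j : l₀ ≤ j := Nat.lt_succ_iff.1 (Finset.mem_range.1 hl₀r)
  rw [hLz l₀ hl₀j hl₀low, zero_add] at hl₀ne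
  obtain ⟨h₀, hh₀mem, hh₀ne⟩ := Finset.exists_ne_zero_of_sum_ne_zero hl₀ne
  have hcond : Js < h₀ ∧ h₀ ≤ j := by
    by_contra hc; rw [if_neg hc] at hh₀ne; exact hh₀ne rfl
  rw [if_pos hcond] at hh₀ne
  have hF : 0 < cornerMidFlow x T j M μ l₀ h₀ := lt_of_le_of_ne (hF0 l₀ h₀) (Ne.symm hh₀ne)
  obtain ⟨q1, q2, q3, q4, q5, -⟩ := hsup l₀ h₀ hh₀ne
  have hl₀M : l₀ ≤ M := hlowM l₀ h₀ hF
  have hμl₀ : 0 < μ l₀ := hlowpos l₀ h₀ hF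
  have hl₀h₀ : l₀ ≠ h₀ := by
    intro e; have : (l₀ : ℝ) = h₀ := by exact_mod_cast e
    linarith
  set c₀ := usage x T j l₀ h₀ with hc₀
  have hc₀pos : 0 < c₀ := usage_pos_of_compat x T j l₀ h₀ hx0 hx1 q3 (by
    by_contra hge; push Not at hge; have : (h₀ : ℝ) ≤ l₀ := by exact_mod_cast hge
    linarith) (Or.inr q5)
  -- the one-low conclusion from the names `l₀, h₀` and an absorber
  have one_low : ∀ (g : ℕ) (t₂' s₁' : ℝ), (s₁' ≠ 0 → ¬ (2 * (g : ℝ) < T ∧ g ≤ j)) →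
      (∀ k, μ k ≠ 0 → ((1 : ℝ) ≠ 0 ∧ (k = l₀ ∨ k = h₀)) ∨ (t₂' ≠ 0 ∧ (k = 0 ∨ k = 0)) ∨ (s₁' ≠ 0 ∧ k = g) ∨
        ((0 : ℝ) ≠ 0 ∧ k = 0) ∨ ((0 : ℝ) ≠ 0 ∧ k = 0)) → t₂' = 0 →
      (∃ q, q ≤ j ∧ ∀ k, k ≤ j → 2 * (k : ℝ) < T → μ k ≠ 0 → k = q) ∨
      (∃ l₁ h₁ l₂ h₂, AtomData x T j M l₁ h₁ l₂ h₂ ∧ ((l₁ < l₂ ∧ h₂ ≤ h₁) ∨ (l₂ < l₁ ∧ h₁ ≤ h₂)) ∧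
        ∀ b, μ b = atomLaw x T j l₁ h₁ l₂ h₂ b) := by
    intro g t₂' s₁' hg hnames ht₂
    refine Or.inl ⟨l₀, hl₀j, fun k hkj hklow hk => ?_⟩
    rcases hnames k hk with ⟨-, hk'⟩ | ⟨ht, -⟩ | ⟨hs, hk'⟩ | ⟨hs, -⟩ | ⟨hr, -⟩
    · rcases hk' with e | e
      · exact e
      · exfalso; rw [e] at hklow; linarith
    · exact absurd ht₂ ht
    · exfalso; rw [hk'] at hklow hkj; exact hg hs ⟨hklow, hkj⟩
    · exact absurd rfl hs
    · exact absurd rfl hr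
  by_cases hcu : c₀ = x / (1 - x)
  · -- (B i) the segment alone
    have hpc : ∀ J, J ≤ j → j ≤ J + w → (∀ l, J < l → l ≤ j → 2 * (l : ℝ) < T → μ l = 0) →
        x / (1 - x) * windowS x T j M μ J = ∑ h ∈ Finset.Ico (J + 1) (M + 1), μ h →
        0 < ∑ h ∈ Finset.Ico (J + 1) (M + 1), μ h →
        pieceG x T j M l₀ h₀ 0 0 0 0 1 0 0 0 0 J = 0 := by
      intro J h1 h2 h3 h4 h5
      have hJle : J ≤ Js := hmax J h1 h2 h3 h4 h5
      unfold pieceG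
      rw [if_pos (show J < h₀ ∧ h₀ ≤ M from ⟨by omega, q4⟩), if_pos (show J < h₀ by omega)]
      simp only [zero_mul, mul_zero, ite_self]
      rw [← hc₀, hcu]; ring
    have hbne : pertLaw x T j μ l₀ h₀ 0 0 0 0 0 1 0 0 0 0 l₀ - μ l₀ ≠ 0 := by
      unfold pertLaw; rw [if_pos rfl, if_neg hl₀h₀]; simp
    obtain ⟨s, hs0, -, hnames⟩ := law_eq_of_pieces x T M j w v hx0 hx1 hvext l₀ h₀ 0 0 0 0 0 1 0 0 0 0
      (fun _ => hF) (fun h => absurd rfl h) (fun h => absurd rfl h) (fun h => absurd rfl h) (fun h => absurd rfl h)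
      hpc l₀ hl₀M hbne
    exact one_low 0 0 0 (fun h => absurd rfl h) hnames rfl
  by_cases hres : ∃ h₂, μ h₂ ≠ 0 ∧ Js < h₂ ∧ h₂ ≤ j ∧ ¬ (2 * (h₂ : ℝ) < T) ∧
      0 < μ h₂ - ∑ a ∈ Finset.range (j + 1), usage x T j a h₂ * cornerMidFlow x T j M μ a h₂
  · -- (B ii) an absorber beyond `J*` with residual capacity
    obtain ⟨h₂, hμ2, hJ2, h2j, hnl2, hres2⟩ := hres
    have h2M : h₂ ≤ M := hleM h₂ (lt_of_le_of_ne (hμ0 h₂) (Ne.symm hμ2))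
    have hl₀h₂ : l₀ ≠ h₂ := by intro e; rw [e] at hl₀low; exact hnl2 hl₀low
    have hpc : ∀ J, J ≤ j → j ≤ J + w → (∀ l, J < l → l ≤ j → 2 * (l : ℝ) < T → μ l = 0) →
        x / (1 - x) * windowS x T j M μ J = ∑ h ∈ Finset.Ico (J + 1) (M + 1), μ h →
        0 < ∑ h ∈ Finset.Ico (J + 1) (M + 1), μ h →
        pieceG x T j M l₀ h₀ 0 0 h₂ 0 1 0 (x / (1 - x) - c₀) 0 0 J = 0 := by
      intro J h1 h2 h3 h4 h5
      have hJle : J ≤ Js := hmax J h1 h2 h3 h4 h5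
      unfold pieceG
      rw [if_pos (show J < h₀ ∧ h₀ ≤ M from ⟨by omega, q4⟩), if_pos (show J < h₀ by omega),
        if_pos (show J < h₂ ∧ h₂ ≤ M from ⟨by omega, h2M⟩)]
      simp only [zero_mul, mul_zero, ite_self]
      ring
    have hbne : pertLaw x T j μ l₀ h₀ 0 0 h₂ 0 0 1 0 (x / (1 - x) - c₀) 0 0 l₀ - μ l₀ ≠ 0 := by
      unfold pertLaw; rw [if_pos rfl, if_neg hl₀h₀, if_neg hl₀h₂]; simp
    obtain ⟨s, hs0, -, hnames⟩ := law_eq_of_pieces x T M j w v hx0 hx1 hvext l₀ h₀ 0 0 h₂ 0 0 1 0 (x / (1 - x) - c₀) 0 0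
      (fun _ => hF) (fun h => absurd rfl h)
      (fun _ => ⟨h2M, fun hc => hnl2 hc.1, hres2⟩) (fun h => absurd rfl h) (fun h => absurd rfl h) hpc l₀ hl₀M hbne
    exact one_low h₂ 0 (x / (1 - x) - c₀) (fun _ hc => hnl2 hc.1) hnames rfl
  by_cases hseg2 : ∃ l' h', 0 < cornerMidFlow x T j M μ l' h' ∧ Js < h' ∧ h' ≤ j ∧ ¬ (l' = l₀ ∧ h' = h₀)
  · -- (B iii) a second segment beyond `J*`
    obtain ⟨l', h', hF', hJ', h'j, hne'⟩ := hseg2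
    obtain ⟨p1, p2, p3, p4, p5, -⟩ := hsup l' h' (ne_of_gt hF')
    have hl'M : l' ≤ M := hlowM l' h' hF'
    have hμl' : 0 < μ l' := hlowpos l' h' hF'
    set c' := usage x T j l' h' with hc'
    have hc'pos : 0 < c' := usage_pos_of_compat x T j l' h' hx0 hx1 p3 (by
      by_contra hge; push Not at hge; have : (h' : ℝ) ≤ l' := by exact_mod_cast hge
      linarith) (Or.inr p5)
    have hl'h₀ : l' ≠ h₀ := by
      intro e; have : (l' : ℝ) = h₀ := by exact_mod_cast e
      linarith
    have hl'h' : l' ≠ h' := by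
      intro e; have : (l' : ℝ) = h' := by exact_mod_cast e
      linarith
    have hh'l₀ : h' ≠ l₀ := by
      intro e; have : (h' : ℝ) = l₀ := by exact_mod_cast e
      linarith
    have ht₂ : x / (1 - x) - c₀ ≠ 0 := fun h => hcu (by linarith)
    have hpc : ∀ J, J ≤ j → j ≤ J + w → (∀ l, J < l → l ≤ j → 2 * (l : ℝ) < T → μ l = 0) →
        x / (1 - x) * windowS x T j M μ J = ∑ h ∈ Finset.Ico (J + 1) (M + 1), μ h →
        0 < ∑ h ∈ Finset.Ico (J + 1) (M + 1), μ h →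
        pieceG x T j M l₀ h₀ l' h' 0 0 (c' - x / (1 - x)) (x / (1 - x) - c₀) 0 0 0 J = 0 := by
      intro J h1 h2 h3 h4 h5
      have hJle : J ≤ Js := hmax J h1 h2 h3 h4 h5
      unfold pieceG
      rw [if_pos (show J < h₀ ∧ h₀ ≤ M from ⟨by omega, q4⟩), if_pos (show J < h₀ by omega),
        if_pos (show J < h' ∧ h' ≤ M from ⟨by omega, p4⟩), if_pos (show J < h' by omega)]
      simp only [mul_zero, ite_self]
      ring
    -- a position where the pieces move mass
    have hb : ∃ b, b ≤ M ∧ pertLaw x T j μ l₀ h₀ l' h' 0 0 0 (c' - x / (1 - x)) (x / (1 - x) - c₀) 0 0 0 b - μ b ≠ 0 := by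
      by_cases hh' : h' = h₀
      · have hl'l₀ : l' ≠ l₀ := fun e => hne' ⟨e, hh'⟩
        refine ⟨l', hl'M, ?_⟩
        unfold pertLaw
        rw [if_neg hl'l₀, if_neg hl'h₀, if_pos rfl, if_neg hl'h']
        intro h; apply ht₂; linarith
      · refine ⟨h', p4, ?_⟩
        unfold pertLaw
        rw [if_neg hh'l₀, if_neg hh', if_neg (Ne.symm hl'h'), if_pos rfl]
        intro h
        have : (x / (1 - x) - c₀) * c' = 0 := by linarith
        rcases mul_eq_zero.1 this with h1 | h1
        · exact ht₂ h1
        · linarith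
    obtain ⟨b, hbM, hbne⟩ := hb
    obtain ⟨s, hs0, hδ, hnames⟩ := law_eq_of_pieces x T M j w v hx0 hx1 hvext l₀ h₀ l' h' 0 0 0 (c' - x / (1 - x))
      (x / (1 - x) - c₀) 0 0 0
      (fun _ => hF) (fun _ => hF') (fun h => absurd rfl h) (fun h => absurd rfl h) (fun h => absurd rfl h) hpc b hbM hbne
    by_cases hll : l' = l₀
    · -- the same low: at most one low
      refine Or.inl ⟨l₀, hl₀j, fun k hkj hklow hk => ?_⟩
      rcases hnames k hk with ⟨-, hk'⟩ | ⟨-, hk'⟩ | ⟨hs, -⟩ | ⟨hs, -⟩ | ⟨hr, -⟩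
      · rcases hk' with e | e
        · exact e
        · exfalso; rw [e] at hklow; linarith
      · rcases hk' with e | e
        · rw [e, hll]
        · exfalso; rw [e] at hklow; linarith
      · exact absurd rfl hs
      · exact absurd rfl hs
      · exact absurd rfl hr
    · -- two distinct lows: the balanced atom
      -- the move, explicitly
      have hδform : ∀ k, pertLaw x T j μ l₀ h₀ l' h' 0 0 0 (c' - x / (1 - x)) (x / (1 - x) - c₀) 0 0 0 k - μ k
          = (c' - x / (1 - x)) * (𝟙[k, l₀] + c₀ * 𝟙[k, h₀]) + (x / (1 - x) - c₀) * (𝟙[k, l'] + c' * 𝟙[k, h']) := by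
        intro k; unfold pertLaw; ring
      -- the low masses
      have e₀ : s * μ l₀ = c' - x / (1 - x) := by
        rw [← hδ l₀ hl₀M, hδform, if_pos rfl, if_neg hl₀h₀, if_neg (Ne.symm hll), if_neg hh'l₀.symm]; ring
      have e' : s * μ l' = x / (1 - x) - c₀ := by
        rw [← hδ l' hl'M, hδform, if_neg hll, if_neg hl'h₀, if_pos rfl, if_neg hl'h']; ring
      have hstair : (l₀ < l' → h' ≤ h₀) ∧ (l' < l₀ → h₀ ≤ h') :=
        ⟨fun h => corner_staircase x T j M μ hx0 hx1 hμ0 l₀ h₀ l' h' hF hF' h,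
         fun h => corner_staircase x T j M μ hx0 hx1 hμ0 l' h' l₀ h₀ hF' hF h⟩
      rcases lt_or_gt_of_ne hs0 with hsneg | hspos
      · -- `s < 0`: `c′ < u < c₀`, expensive segment `(l₀, h₀)`, cheap `(l′, h′)`
        have h1 : c' < x / (1 - x) := by nlinarith [mul_pos_of_neg_of_neg hsneg (show -μ l₀ < 0 by linarith)]
        have h2 : x / (1 - x) < c₀ := by nlinarith [mul_pos_of_neg_of_neg hsneg (show -μ l' < 0 by linarith)]
        have hcc : usage x T j l₀ h₀ ≠ usage x T j l' h' := by rw [← hc₀, ← hc']; exact ne_of_gt (h1.trans h2)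
        refine Or.inr ⟨l₀, h₀, l', h', ⟨q1, q3, q2, q4, q5, p1, p3, p2, p4, p5, Ne.symm hll, ?_, ?_⟩, ?_, fun k => ?_⟩
        · rw [← hc']; exact h1
        · rw [← hc₀]; exact h2
        · rcases lt_or_gt_of_ne (Ne.symm hll) with h | h
          · exact Or.inl ⟨h, hstair.1 h⟩
          · exact Or.inr ⟨h, hstair.2 h⟩
        by_cases hkM : k ≤ M
        · refine eq_of_smul_eq_smul hs0 (L := -((usage x T j l₀ h₀ - usage x T j l' h') / (1 - x))) (fun b hb => ?_) hμ1
            (sum_range_atomLaw x T j l₀ h₀ l' h' hx1 hcc hl₀M q4 hl'M p4) k hkM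
          rw [mul_neg, atomLaw_mul x T j l₀ h₀ l' h' hx1 hcc, ← hδ b hb, hδform]
          simp only [hc₀, hc']
          ring
        · push Not at hkM
          rw [hμM k hkM, atomLaw_eq_zero_of_gt x T j l₀ h₀ l' h' hl₀M q4 hl'M p4 hkM]
      · -- `s > 0`: `c₀ < u < c′`, expensive segment `(l′, h′)`, cheap `(l₀, h₀)`
        have h1 : x / (1 - x) < c' := by nlinarith [mul_pos hspos hμl₀]
        have h2 : c₀ < x / (1 - x) := by nlinarith [mul_pos hspos hμl']
        have hcc : usage x T j l' h' ≠ usage x T j l₀ h₀ := by rw [← hc₀, ← hc']; exact ne_of_gt (h2.trans h1)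
        refine Or.inr ⟨l', h', l₀, h₀, ⟨p1, p3, p2, p4, p5, q1, q3, q2, q4, q5, hll, ?_, ?_⟩, ?_, fun k => ?_⟩
        · rw [← hc₀]; exact h2
        · rw [← hc']; exact h1
        · rcases lt_or_gt_of_ne hll with h | h
          · exact Or.inl ⟨h, hstair.2 h⟩
          · exact Or.inr ⟨h, hstair.1 h⟩
        by_cases hkM : k ≤ M
        · refine eq_of_smul_eq_smul hs0 (L := (usage x T j l' h' - usage x T j l₀ h₀) / (1 - x)) (fun b hb => ?_) hμ1
            (sum_range_atomLaw x T j l' h' l₀ h₀ hx1 hcc hl'M p4 hl₀M q4) k hkM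
          rw [atomLaw_mul x T j l' h' l₀ h₀ hx1 hcc, ← hδ b hb, hδform]
          simp only [hc₀, hc']
          ring
        · push Not at hkM
          rw [hμM k hkM, atomLaw_eq_zero_of_gt x T j l' h' l₀ h₀ hl'M p4 hl₀M q4 hkM]
  · -- (B iv) the remaining configuration contradicts `c₀ ≠ u`
    exfalso
    push Not at hres hseg2
    have hzero : ∀ h, Js < h → h ≠ h₀ → μ h = 0 := by
      intro h hJh hne
      by_contra hμh
      have hpos : 0 < μ h := lt_of_le_of_ne (hμ0 h) (Ne.symm hμh)
      have hhM : h ≤ M := hleM h hpos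
      have hhj : h ≤ j := by
        by_contra hgt; push Not at hgt; exact hμh (hnogiant h hgt hhM)
      have hnl : ¬ (2 * (h : ℝ) < T) := fun hlow => hμh (hgap h hJh hhj hlow)
      have hr := hres h hμh hJh hhj (not_lt.1 hnl)
      have hload0 : ∑ a ∈ Finset.range (j + 1), usage x T j a h * cornerMidFlow x T j M μ a h = 0 := by
        refine Finset.sum_eq_zero fun a _ => ?_
        by_cases hz : cornerMidFlow x T j M μ a h = 0
        · rw [hz, mul_zero]
        · exact absurd (hseg2 a h (lt_of_le_of_ne (hF0 a h) (Ne.symm hz)) hJh hhj).2 hne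
      rw [hload0] at hr
      linarith
    have hΓ' : ∑ h ∈ Finset.Ico (Js + 1) (M + 1), μ h = μ h₀ := by
      rw [Finset.sum_eq_single h₀]
      · intro h hh hne; exact hzero h (Finset.mem_Ico.1 hh).1 hne
      · intro hn; exact absurd (Finset.mem_Ico.2 ⟨hcond.1, Nat.lt_succ_of_le q4⟩) hn
    have hμh₀ : μ h₀ = c₀ * cornerMidFlow x T j M μ l₀ h₀ := by
      have hload : ∑ a ∈ Finset.range (j + 1), usage x T j a h₀ * cornerMidFlow x T j M μ a h₀
          = c₀ * cornerMidFlow x T j M μ l₀ h₀ := by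
        rw [Finset.sum_eq_single l₀]
        · intro a _ hne
          by_cases hz : cornerMidFlow x T j M μ a h₀ = 0
          · rw [hz, mul_zero]
          · exact absurd (hseg2 a h₀ (lt_of_le_of_ne (hF0 a h₀) (Ne.symm hz)) hcond.1 hcond.2).1 hne
        · intro hn; exact absurd (Finset.mem_range.2 (Nat.lt_succ_of_le q1)) hn
      have hcol' : ∑ a ∈ Finset.range (j + 1), usage x T j a h₀ * cornerMidFlow x T j M μ a h₀ ≤ μ h₀ := hcol h₀
      rw [hload] at hcol'
      have hμpos : μ h₀ ≠ 0 := by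
        have : 0 < c₀ * cornerMidFlow x T j M μ l₀ h₀ := mul_pos hc₀pos hF
        intro hz; linarith
      have h2 : T ≤ 2 * (h₀ : ℝ) := by linarith
      have hr := hres h₀ hμpos hcond.1 hcond.2 h2
      rw [hload] at hr
      linarith
    have hS' : windowS x T j M μ Js = cornerMidFlow x T j M μ l₀ h₀ := by
      unfold windowS
      rw [Finset.sum_eq_single l₀]
      · rw [hLz l₀ hl₀j hl₀low, zero_add, Finset.sum_eq_single h₀]
        · rw [if_pos hcond]
        · intro h _ hne
          by_cases hc : Js < h ∧ h ≤ j
          · rw [if_pos hc]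
            by_contra hz
            exact hne (hseg2 l₀ h (lt_of_le_of_ne (hF0 l₀ h) (Ne.symm hz)) hc.1 hc.2).2
          · rw [if_neg hc]
        · intro hn; exact absurd (Finset.mem_range.2 (Nat.lt_succ_of_le q4)) hn
      · intro l hl hne
        obtain ⟨r1, r2⟩ := Finset.mem_filter.1 hl
        rw [hLz l (Nat.lt_succ_iff.1 (Finset.mem_range.1 r1)) r2, zero_add]
        refine Finset.sum_eq_zero fun h _ => ?_
        by_cases hc : Js < h ∧ h ≤ j
        · rw [if_pos hc]
          by_contra hz
          exact hne (hseg2 l h (lt_of_le_of_ne (hF0 l h) (Ne.symm hz)) hc.1 hc.2).1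
        · rw [if_neg hc]
      · intro hn; exact absurd hl₀mem hn
    rw [hS', hΓ', hμh₀] at hS
    have : (x / (1 - x) - c₀) * cornerMidFlow x T j M μ l₀ h₀ = 0 := by linarith
    rcases mul_eq_zero.1 this with h1 | h1
    · exact hcu (by linarith)
    · linarith


end LawDec

end Quant

end Summit.CriticalPhenomena.PercolationContinuityZ3.Theorems
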